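import Summits.QuantumFields.YangMills.Theorems.FluctuationComparisonRegPrIntLS2BetaRelativeTowerSupProfileVar
import Summits.QuantumFields.YangMills.Theorems.FluctuationComparisonRegPrIntLS2BetaLogChordComparison
import Summits.QuantumFields.YangMills.Theorems.FluctuationComparisonRegPrIntLS2BetaContractingSupVarStart
import HarnessLib

/-!
# S2β · (L♭) road, way-out (a) — THE `v`-STEP OF THE TWO-PROFILE SUP RECURSION: the adjacent TRANSVERSE parallel variation of the current level from the
# coarser level's, `‖log W⟨z+e_ι,κ⟩ − log W⟨z,κ⟩‖ ≤ (L⁻¹)²·v + 2(1+σ²∕3)·( N_P·(aW + (L⁻¹)²(aX + (aX+12s²)² + 40sv + 8v² + 35s³)) + ((d+2)L)²∕2·aW )` (`d = 3`)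

Cell `ym3-torus` (rung R3 = continuum `SU(2)` Yang–Mills on the three-torus — NOT d = 4, NOT infinite volume, NOT a mass gap, NOT Clay).
Width seat «width 21» `ym3-torus-px21` (gen 24); `--kind proof --supports stmt-QuantumFields-20520 --as helper`, count-neutral, DEFINITION-FREE
(0 `def`, 0 `instance`, 0 `notation`, 0 `sorry`, default heartbeats).  The companion of px21 g23's ✓`…RelativeTowerSupProfileVar.arc_le_sup_step_hatLift_var`
(the `s`-STEP) in px17 g19's §2∕§3 shape (✓`…RelativeTowerSupProfile`): a generic comb-axial-pair letter, then the hat-lift instantiation.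

WHAT.
* §1 ★ `norm_logVec_lift_sub_shift_le` — THE LIFT'S ADJACENT TRANSVERSE VARIATION CONTRACTS BY `L⁻²`, CONSTANT ONE: `‖log V⟨z+e_ι,κ⟩ − log V⟨z,κ⟩‖ ≤ (L⁻¹)²·v`
  (`ι ≠ κ`; px12 g23's ✓`logVec_lift` (the lift is LINEAR in log coordinates) + px21 g23's ✓`norm_sub_shift_hat_le` ∘ ✓`sub_shift_hat_eq` with `A := L⁻¹·log X`:
  the column weights move by `1∕L` and read ONE coarse transverse step).
* §2 ★★ `norm_logVec_sub_shift_le_of_axial_pair` — for ANY comb-axial pair `(W, U₀)` on `SU(2)` ((T4)), plaquettes `≤ aW, aU`, spine quotients `≤ aS`, all arcs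
  `≤ σ` (`σ² ≤ 3`), `U₀`'s adjacent transverse variation `≤ vU`:  `‖log W⟨z+e_ι,κ⟩ − log W⟨z,κ⟩‖ ≤ vU + 2(1+σ²∕3)·(N_P(aW + aU) + aS)` — px12 g24's sharp
  log-vs-chord letter ✓`norm_logVec_sub_le_mul_dist1` (leading constant ONE) ∘ px17's ✓`dist1_mul_inv_le_of_axial_pair`, at both bonds.
* §3 ★★★ `var_le_sup_step_hatLift` (`d = 3`) — THE `v`-STEP: D5's hypotheses VERBATIM + the current level's arcs `≤ σ` with `L⁻¹s ≤ σ`, `σ² ≤ 3` ⟹ for EVERY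
  adjacent transverse pair
      `‖log W⟨z+e_ι,κ⟩ − log W⟨z,κ⟩‖ ≤ (L⁻¹)²·v + 2(1+σ²∕3)·( N_P·(aW + (L⁻¹)²·(aX + (aX+12s²)² + 40sv + 8v² + 35s³)) + 2·(((d+2)L)²∕4·aW) )`,
  the lift's plaquettes read through the SECOND-ORDER letter ✓p827730 `dist1_plaqHol_lift_le_second_of_forall` (`σΔ`, `Δ²` — NO linear `Δ`).
* §4 ★ `refined_poly_le` (`(aX+12s²)² ≤ aX² + (3∕2)aX + 36s³` at `s ≤ 1∕4`), ★★ `var_le_sup_step_hatLift_poly` — §3 at `σ = 1∕4` in the currency of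
  ✓p827708 `sup_bootstrap_two_profile`: `v_t ≤ r₁·v + ρ′ + D₃·s³ + D_sv·s·v + D_vv·v²` with `r₁ = L⁻²`, `κ′ := (49∕24)·N_P·L⁻²`, `D₃ = 71κ′`, `D_sv = 40κ′`,
  `D_vv = 8κ′`, `ρ′ = (49∕24)·((N_P + ((d+2)L)²∕2)·aW + N_P L⁻²·(aX² + (5∕2)aX))`; and ★★ `sup_bootstrap_two_profile'` — the bootstrap whose `v`-step may
  also use `s t ≤ σ₀` (the downward induction proves `s t ≤ M` first), which is what §3's arc hypothesis on `W` needs.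

WHY THE SECOND-ORDER LETTER AND NOT THE ALL-ORDERS ONE HERE (located, numbers).  A lift letter LINEAR in the variation (px12 g25's D6: `(π²∕4)(F + 4v) + 4v + 16sv`,
or the toron edition `2Δ + 4σΔ`) is harmless in the `s`-step but enters the `v`-step as `r₁ = L⁻² + 2(1+σ²∕3)·N_P L⁻²·(π²+4) ≈ 27` at `L = 5` (`→ 2(π²+4)` as
`L → ∞`): no contraction.  With the second-order letter `r₁ = L⁻²` and the `v`-terms are `sv`, `v²` (guarded).  Both letters bound the same plaquettes; the
bootstrap takes each where it is cheap.

THE LOCATED THRESHOLD (numbers, not adjectives; `d = 3`, `L = 5`, `N_P L⁻² = 24∕25`).  `D_sv = 40·(49∕24)·0.96 ≈ 78.4`, so ✓`ceilings_of_quarters`' `D_sv·M ≤ (1−r₁)∕4`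
gives `M ≤ 0.0031` — WORSE than the one-profile start `M(L) ≈ 0.0104` of ✓`…ContractingSupStart`.  The crude factor `2·N_P` (two unrelated correction factors)
is sharp up to `≈ 4.5` for a SUP profile: `v` maximises over cross-block pairs, and at a block CORNER the two correction factors live in different block pairs
(the 1-chain identity `FL^κ(x+e_ι) − FL^κ(x) = ∂p(x;ι,κ) − ∂□_L(c;ι,κ) − FL^ι(x) + FL^ι(x+e_κ)` reroutes them to a same-face pair, one lift plaquette and the
coarse plaquette `hol_V(∂□_L) = X(∂q)` — a `÷ 4.5` at best).  The deciding lever of way-out (a) is therefore the lift letter's constants `(40, 8, 35)` against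
px21 g23's measured intrinsic scale `≈ 1` (kit j344254∕j344270), not the pair count.  This file is the formal closure of (a)'s kinematics with the crude constants.

HONEST SCOPE.  Plumbing over landed letters + elementary real algebra; every constant explicit and crude; nothing of Bałaban's analysis is asserted or proved
([Balaban1985RegularSpaces] (1.29) p.81: the regular spaces bound the small field AND its covariant derivatives — the printed analogue of `(s, v)`; Lemma 1
(1.24)–(1.26) p.79 the one-cube sup letters); the two-profile START, the top small-variation gauge, (L♭), (D-stage), GAP♯∘ (`stub_uniformFibreGapOrbit`, registry
untouched, 0∕5), S2β, crux 20520 and `YM3TorusSU2` are NOT proved; no registered stub is closed; rung R3 = SU(2) YM₃ on T³ — NOT d = 4, NOT infinite volume,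
NOT a mass gap, NOT Clay; the Yang–Mills mass gap is NOT proved.
References: T. Bałaban, CMP **99** (1985) 75–102 [Balaban1985RegularSpaces]; CMP **98** (1985) 17–51 [Balaban1985Averaging]; CMP **109** (1987) 249–301 [Balaban1987RG1].
-/

set_option autoImplicit false

noncomputable section

namespace Summit.QuantumFields.YangMills.Theorems.FluctuationComparisonRegPrIntLS2BetaRelativeTowerVarStep

open Finset
open scoped Real
open Literature.MathematicalPhysics.QuantumLattice (su2Quat)
open Literature.MathematicalPhysics.QuantumFieldTheory.Balaban1983to89
open T4Continuum BlockAveraging LatticeWordStokes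
open B10Eq27TorusAxialLog (rel axialT)
open T4CubeChartGnomonic (SU2)
open T4HaarSU2ExpChart (expPoint)
open T4ExpWindowSmallField (logVec)
open Summit.QuantumFields.YangMills.Theorems.FluctuationComparisonRegPrIntLS2BetaRelativeFieldLetter (dist1_axialAvg_mul_inv_eq_corr)
open Summit.QuantumFields.YangMills.Theorems.FluctuationComparisonRegPrIntLS2BetaWhitneyHatLift (arc_lift_le axialAvg_lift)
open Summit.QuantumFields.YangMills.Theorems.FluctuationComparisonRegPrIntLS2BetaWhitneyHatLiftRelative (logVec_lift)
open Summit.QuantumFields.YangMills.Theorems.FluctuationComparisonRegPrIntLS2BetaWhitneyHatLiftCurvatureSecondOrder (norm_sub_shift_hat_le)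
open Summit.QuantumFields.YangMills.Theorems.FluctuationComparisonRegPrIntLS2BetaWhitneyHatLiftCurvatureSecondOrderGlobal (dist1_plaqHol_lift_le_second_of_forall)
open Summit.QuantumFields.YangMills.Theorems.FluctuationComparisonRegPrIntLS2BetaRelativeTowerSupProfile (dist1_mul_inv_le_of_axial_pair)
open Summit.QuantumFields.YangMills.Theorems.FluctuationComparisonRegPrIntLS2BetaLogChordComparison (norm_logVec_sub_le_mul_dist1)
open Summit.QuantumFields.YangMills.Theorems.FluctuationComparisonRegPrIntLS2BetaContractingSupRecursion (le_of_sum_le_of_nonneg)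

variable {P : Params}

/-! ## §1 The hat lift's adjacent transverse variation contracts by `L⁻²` -/

section Lift

variable {t : ℕ}

/-- ★ **THE LIFT'S ADJACENT TRANSVERSE VARIATION CONTRACTS BY `L⁻²`, CONSTANT ONE.**  Coarse arcs `≤ s < π` and adjacent transverse parallel variations of
`log X` `≤ v` (`‖log X⟨y+e_ι,κ⟩ − log X⟨y,κ⟩‖ ≤ v`, `ι ≠ κ`) ⟹ the hat lift has `‖log V⟨z+e_ι,κ⟩ − log V⟨z,κ⟩‖ ≤ (L⁻¹)²·v` for every fine site `z` and `ι ≠ κ`: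
one `L⁻¹` is the lift's scaling, the other the slope of the hat (✓`sub_shift_hat_eq`: the column weights of `z` and `z + e_ι` differ by `L⁻¹ ×` a convex combination
of ONE-step coarse transverse differences). [cite: Balaban1985RegularSpaces, (1.29) p.81] -/
theorem norm_logVec_lift_sub_shift_le (ht : t + 1 ≤ P.m + P.K) (w : PBond P t → PBond P (t + 1) → ℝ)
    (hw : ∀ b e, w b e = if e.dir = b.dir ∧ (b.src b.dir - emb e.src b.dir).val < P.L then
      ∏ ν ∈ Finset.univ.erase b.dir, max 0 (1 - ((rel (emb e.src) b.src ν).natAbs : ℝ) / P.L) else 0)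
    (X : GaugeField P (t + 1) SU2) (V : GaugeField P t SU2)
    (hV : ∀ b, V b = expPoint (∑ e, w b e • ((P.L : ℝ)⁻¹ • logVec (su2Quat (X e)))))
    {v : ℝ} (hv : ∀ (y : Site P (t + 1)) (ι κ : Fin P.d), ι ≠ κ →
      ‖logVec (su2Quat (X ⟨y.shift ι, κ⟩)) - logVec (su2Quat (X ⟨y, κ⟩))‖ ≤ v)
    (z : Site P t) {ι κ : Fin P.d} (hικ : ι ≠ κ) :
    ‖logVec (su2Quat (V ⟨z.shift ι, κ⟩)) - logVec (su2Quat (V ⟨z, κ⟩))‖ ≤ ((P.L : ℝ)⁻¹) ^ 2 * v := by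
  have hL0 : 0 ≤ (P.L : ℝ)⁻¹ := inv_nonneg.mpr (Nat.cast_nonneg _)
  rw [logVec_lift ht w hw X V hV, logVec_lift ht w hw X V hV, norm_sub_rev]
  have h := norm_sub_shift_hat_le ht w hw (fun e => (P.L : ℝ)⁻¹ • logVec (su2Quat (X e)))
    (fun b => ∑ e, w b e • ((P.L : ℝ)⁻¹ • logVec (su2Quat (X e)))) (fun _ => rfl) z hικ (M := (P.L : ℝ)⁻¹ * v)
    fun y _ => by
      rw [← smul_sub, norm_smul, Real.norm_eq_abs, abs_of_nonneg hL0, norm_sub_rev]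
      exact mul_le_mul_of_nonneg_left (hv y ι κ hικ) hL0
  refine h.trans (le_of_eq ?_)
  ring

end Lift

/-! ## §2 The adjacent transverse VARIATION letter for a comb-axial pair on `SU(2)` -/

section Pair

variable {j : ℕ}

/-- ★★ **THE VARIATION LETTER FOR A COMB-AXIAL PAIR** (height `j`, standing range).  `W` comb-axial RELATIVE TO `U₀` from every block centre ((T4)); plaquettes of
`W` `≤ aW`, of `U₀` `≤ aU`; spine quotients `≤ aS`; ALL arcs of `W` and of `U₀` `≤ σ` with `σ² ≤ 3`; and the background's adjacent transverse parallel variation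
`‖log U₀⟨z+e_ι,κ⟩ − log U₀⟨z,κ⟩‖ ≤ vU` (`ι ≠ κ`).  Then for EVERY site `z` and `ι ≠ κ`
    `‖log W⟨z+e_ι,κ⟩ − log W⟨z,κ⟩‖ ≤ vU + 2·(1 + σ²∕3)·(N_P·(aW + aU) + aS)`,  `N_P := (d−1)·((L−1)∕2)·(L+1)`
— the background's variation plus TWO correction factors (✓`dist1_mul_inv_le_of_axial_pair`) read in log currency by the sharp log-vs-chord letter
✓`norm_logVec_sub_le_mul_dist1` (leading constant ONE, defect `σ²∕3`). [cite: Balaban1985RegularSpaces, Lemma 1 (1.25)-(1.26) p.79, (1.29) p.81; Balaban1987RG1, (0.3)-(0.4) pp.252-253] -/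
theorem norm_logVec_sub_shift_le_of_axial_pair (hj : j + 1 ≤ P.m + P.K) (W U₀ : GaugeField P j SU2)
    (hax : ∀ z : Site P j, axialT W (emb (blockOf z)) z = axialT U₀ (emb (blockOf z)) z)
    {aW aU aS σ vU : ℝ} (haW : 0 ≤ aW) (haU : 0 ≤ aU) (haS : 0 ≤ aS)
    (hWp : ∀ p : Plaq P j, dist1 (GaugeField.plaqHol W p) ≤ aW) (hUp : ∀ p : Plaq P j, dist1 (GaugeField.plaqHol U₀ p) ≤ aU)
    (hsp : ∀ c : PBond P (j + 1), dist1 (AveragingRT.axialAvg W c * (AveragingRT.axialAvg U₀ c)⁻¹) ≤ aS)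
    (hWσ : ∀ b : PBond P j, ‖logVec (su2Quat (W b))‖ ≤ σ) (hUσ : ∀ b : PBond P j, ‖logVec (su2Quat (U₀ b))‖ ≤ σ) (hσ : σ ^ 2 ≤ 3)
    (hvU : ∀ (z : Site P j) (ι κ : Fin P.d), ι ≠ κ →
      ‖logVec (su2Quat (U₀ ⟨z.shift ι, κ⟩)) - logVec (su2Quat (U₀ ⟨z, κ⟩))‖ ≤ vU)
    (z : Site P j) {ι κ : Fin P.d} (hικ : ι ≠ κ) :
    ‖logVec (su2Quat (W ⟨z.shift ι, κ⟩)) - logVec (su2Quat (W ⟨z, κ⟩))‖ ≤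
      vU + 2 * (1 + σ ^ 2 / 3) * ((((P.d - 1) * ((P.L - 1) / 2) * (P.L + 1) : ℕ) : ℝ) * (aW + aU) + aS) := by
  have hk : 0 ≤ 1 + σ ^ 2 / 3 := by positivity
  have hR : ∀ b : PBond P j, ‖logVec (su2Quat (W b)) - logVec (su2Quat (U₀ b))‖ ≤
      (1 + σ ^ 2 / 3) * ((((P.d - 1) * ((P.L - 1) / 2) * (P.L + 1) : ℕ) : ℝ) * (aW + aU) + aS) := fun b =>
    (norm_logVec_sub_le_mul_dist1 (W b) (U₀ b) (hWσ b) (hUσ b) hσ).trans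
      (mul_le_mul_of_nonneg_left (dist1_mul_inv_le_of_axial_pair hj W U₀ hax haW haU haS hWp hUp hsp b) hk)
  have hsplit : logVec (su2Quat (W ⟨z.shift ι, κ⟩)) - logVec (su2Quat (W ⟨z, κ⟩)) =
      (logVec (su2Quat (W ⟨z.shift ι, κ⟩)) - logVec (su2Quat (U₀ ⟨z.shift ι, κ⟩))) +
        (logVec (su2Quat (U₀ ⟨z.shift ι, κ⟩)) - logVec (su2Quat (U₀ ⟨z, κ⟩))) +
        (logVec (su2Quat (U₀ ⟨z, κ⟩)) - logVec (su2Quat (W ⟨z, κ⟩))) := by abel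
  rw [hsplit]
  have h1 := hR ⟨z.shift ι, κ⟩
  have h2 := hvU z ι κ hικ
  have h3 : ‖logVec (su2Quat (U₀ ⟨z, κ⟩)) - logVec (su2Quat (W ⟨z, κ⟩))‖ ≤
      (1 + σ ^ 2 / 3) * ((((P.d - 1) * ((P.L - 1) / 2) * (P.L + 1) : ℕ) : ℝ) * (aW + aU) + aS) := by
    rw [norm_sub_rev]; exact hR ⟨z, κ⟩
  calc _ ≤ ‖logVec (su2Quat (W ⟨z.shift ι, κ⟩)) - logVec (su2Quat (U₀ ⟨z.shift ι, κ⟩))‖ +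
          ‖logVec (su2Quat (U₀ ⟨z.shift ι, κ⟩)) - logVec (su2Quat (U₀ ⟨z, κ⟩))‖ +
          ‖logVec (su2Quat (U₀ ⟨z, κ⟩)) - logVec (su2Quat (W ⟨z, κ⟩))‖ := norm_add₃_le
    _ ≤ _ := by linarith

end Pair

/-! ## §3 `SU(2)`, `d = 3`: the `v`-STEP with the hat lift as background -/

section HatLift

variable {t : ℕ}

/-- ★★★ **THE `v`-STEP OF THE TWO-PROFILE SUP RECURSION** (`d = 3`; companion of ✓`arc_le_sup_step_hatLift_var`).  `X` the coarser field, `V` its hat lift, `W` the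
current level, comb-axial relative to `V` ((T4)) and averaging to `X` ((T5)); `PlaqSmall aW W` inside the `ℰp` guard; chords of `X` `≤ aX`; arcs of `X` `≤ s ≤ 1∕4`;
adjacent TRANSVERSE parallel variations of `log X` `≤ v`; and the current level's arcs `≤ σ` with `L⁻¹·s ≤ σ`, `σ² ≤ 3` (in the tower: `σ = 1∕4`).  Then for EVERY
fine site `z` and `ι ≠ κ`
    `‖log W⟨z+e_ι,κ⟩ − log W⟨z,κ⟩‖ ≤ (L⁻¹)²·v + 2(1+σ²∕3)·( N_P·(aW + (L⁻¹)²·(aX + (aX+12s²)² + 40sv + 8v² + 35s³)) + 2·(((d+2)L)²∕4·aW) )`: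
`r₁ = L⁻²` from §1; the correction factors through the SECOND-ORDER lift letter ✓`dist1_plaqHol_lift_le_second_of_forall` (NO linear `v`), the lift's arcs
✓`arc_lift_le`, spine quotient = correction factor `≤ 2·((d+2)L)²∕4·aW` (✓`dist1_axialAvg_mul_inv_eq_corr` ∘ (T5) ∘ ✓`axialAvg_lift`; lit ✓`dist1_corr_le_two_mul`).
[cite: Balaban1985RegularSpaces, Lemma 1 (1.24)-(1.26) p.79, (1.29) p.81; Balaban1987RG1, (0.4) p.253] -/
theorem var_le_sup_step_hatLift (hd : P.d = 3) (ht : t + 1 ≤ P.m + P.K) (w : PBond P t → PBond P (t + 1) → ℝ)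
    (hw : ∀ b e, w b e = if e.dir = b.dir ∧ (b.src b.dir - emb e.src b.dir).val < P.L then
      ∏ ν ∈ Finset.univ.erase b.dir, max 0 (1 - ((rel (emb e.src) b.src ν).natAbs : ℝ) / P.L) else 0)
    (X : GaugeField P (t + 1) SU2) (V : GaugeField P t SU2)
    (hV : ∀ b, V b = expPoint (∑ e, w b e • ((P.L : ℝ)⁻¹ • logVec (su2Quat (X e)))))
    (W : GaugeField P t SU2)
    (hax : ∀ z : Site P t, axialT W (emb (blockOf z)) z = axialT V (emb (blockOf z)) z)
    (hT5 : avgFun T3UnitLawDensityEML.ℰp W = X)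
    {aW aX s v σ : ℝ} (haW : 0 ≤ aW) (hWs : PlaqSmall aW W)
    (hg1 : ((((P.d + 2) * P.L : ℕ) : ℝ) ^ 2 / 4) * aW < ExpMeanLog.deltaSU (Fin 2))
    (hg2 : ((((P.d + 2) * P.L : ℕ) : ℝ) ^ 2 / 4) * aW ≤ 1 / 6)
    (hXp : ∀ q : Plaq P (t + 1), dist1 (GaugeField.plaqHol X q) ≤ aX)
    (hs : ∀ e : PBond P (t + 1), ‖logVec (su2Quat (X e))‖ ≤ s) (hs4 : s ≤ 1 / 4)
    (hv : ∀ (y : Site P (t + 1)) (ι κ : Fin P.d), ι ≠ κ →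
      ‖logVec (su2Quat (X ⟨y.shift ι, κ⟩)) - logVec (su2Quat (X ⟨y, κ⟩))‖ ≤ v)
    (hWσ : ∀ b : PBond P t, ‖logVec (su2Quat (W b))‖ ≤ σ) (hsσ : (P.L : ℝ)⁻¹ * s ≤ σ) (hσ : σ ^ 2 ≤ 3)
    (z : Site P t) {ι κ : Fin P.d} (hικ : ι ≠ κ) :
    ‖logVec (su2Quat (W ⟨z.shift ι, κ⟩)) - logVec (su2Quat (W ⟨z, κ⟩))‖ ≤ ((P.L : ℝ)⁻¹) ^ 2 * v +
      2 * (1 + σ ^ 2 / 3) * ((((P.d - 1) * ((P.L - 1) / 2) * (P.L + 1) : ℕ) : ℝ) *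
          (aW + ((P.L : ℝ)⁻¹) ^ 2 * (aX + (aX + 12 * s ^ 2) ^ 2 + 40 * s * v + 8 * v ^ 2 + 35 * s ^ 3)) +
        2 * (((((P.d + 2) * P.L : ℕ) : ℝ) ^ 2 / 4) * aW)) := by
  obtain ⟨e₀⟩ : Nonempty (PBond P (t + 1)) := ⟨⟨default, ⟨0, P.hd⟩⟩⟩
  have hs0 : 0 ≤ s := (norm_nonneg _).trans (hs e₀)
  have hv0 : 0 ≤ v := (norm_nonneg _).trans (hv default ⟨0, P.hd⟩ ⟨1, by rw [hd]; norm_num⟩ (by simp [Fin.ext_iff]))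
  have haX : 0 ≤ aX := (GaugeGroup.dist1_nonneg _).trans (hXp ⟨default, ⟨0, P.hd⟩, ⟨1, by rw [hd]; norm_num⟩, by simp [Fin.lt_def]⟩)
  -- plaquettes of `W`
  have hWp : ∀ p : Plaq P t, dist1 (GaugeField.plaqHol W p) ≤ aW := fun p => (hWs p).le
  -- plaquettes of the lift: the SECOND-ORDER letter (global two-profile form)
  have hVp : ∀ p : Plaq P t, dist1 (GaugeField.plaqHol V p)
      ≤ ((P.L : ℝ)⁻¹) ^ 2 * (aX + (aX + 12 * s ^ 2) ^ 2 + 40 * s * v + 8 * v ^ 2 + 35 * s ^ 3) := fun p =>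
    dist1_plaqHol_lift_le_second_of_forall hd ht w hw X V hV hs hs4 hXp hv p
  -- arcs of the lift
  have hVb : ∀ b : PBond P t, ‖logVec (su2Quat (V b))‖ ≤ σ := fun b =>
    (arc_lift_le ht w hw X V hV b fun e _ => hs e).trans hsσ
  -- spine quotient = correction factor ≤ 2·(loop bound)
  have havg : ∀ c : PBond P (t + 1), AveragingRT.axialAvg V c = avgFun T3UnitLawDensityEML.ℰp W c := fun c => by
    rw [axialAvg_lift ht w hw X V hV, hT5]
  have hsp : ∀ c : PBond P (t + 1), dist1 (AveragingRT.axialAvg W c * (AveragingRT.axialAvg V c)⁻¹) ≤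
      2 * (((((P.d + 2) * P.L : ℕ) : ℝ) ^ 2 / 4) * aW) := fun c => by
    rw [dist1_axialAvg_mul_inv_eq_corr _ W V c (havg c)]
    exact BlockAveragingEMLProp2.dist1_corr_le_two_mul W c (fun i => dist1_loopHol_le haW hWs c i) hg1 hg2
  have hU0 : 0 ≤ ((P.L : ℝ)⁻¹) ^ 2 * (aX + (aX + 12 * s ^ 2) ^ 2 + 40 * s * v + 8 * v ^ 2 + 35 * s ^ 3) := by positivity
  have hS0 : 0 ≤ 2 * (((((P.d + 2) * P.L : ℕ) : ℝ) ^ 2 / 4) * aW) := by positivity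
  -- the lift's own transverse variation: `L⁻²·v`
  have h1 : ∀ (z : Site P t) (ι κ : Fin P.d), ι ≠ κ →
      ‖logVec (su2Quat (V ⟨z.shift ι, κ⟩)) - logVec (su2Quat (V ⟨z, κ⟩))‖ ≤ ((P.L : ℝ)⁻¹) ^ 2 * v := fun z ι κ h =>
    norm_logVec_lift_sub_shift_le ht w hw X V hV hv z h
  exact norm_logVec_sub_shift_le_of_axial_pair ht W V hax haW hU0 hS0 hWp hVp hsp hWσ hVb hσ h1 z hικ

end HatLift

/-! ## §4 The recursion currency: the polynomial massage, the `v`-step at `σ = 1∕4`, and the bootstrap that lets the `v`-step use `s t ≤ σ₀` -/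

section Recursion

variable {t : ℕ}

/-- ★ **THE POLYNOMIAL MASSAGE** (`0 ≤ aX`, `0 ≤ s ≤ 1∕4`): `(aX + 12s²)² = aX² + 24aX·s² + 144s⁴ ≤ aX² + (3∕2)aX + 36s³`, so
`aX + (aX+12s²)² + 40sv + 8v² + 35s³ ≤ (aX² + (5∕2)aX) + 71s³ + 40sv + 8v²` — thresholds, CUBE, cross term, square. [folklore] -/
theorem refined_poly_le {aX s v : ℝ} (haX : 0 ≤ aX) (hs0 : 0 ≤ s) (hs4 : s ≤ 1 / 4) :
    aX + (aX + 12 * s ^ 2) ^ 2 + 40 * s * v + 8 * v ^ 2 + 35 * s ^ 3 ≤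
      (aX ^ 2 + 5 / 2 * aX) + 71 * s ^ 3 + 40 * s * v + 8 * v ^ 2 := by
  have hs2 : s ^ 2 ≤ 1 / 16 := by nlinarith
  have h1 : 24 * aX * s ^ 2 ≤ 3 / 2 * aX := by nlinarith
  have h2 : 144 * s ^ 4 ≤ 36 * s ^ 3 := by nlinarith [pow_nonneg hs0 3]
  nlinarith

/-- ★★ **THE `v`-STEP IN THE BOOTSTRAP's CURRENCY** (§3 at `σ = 1∕4`, then `refined_poly_le`; `1 + (1∕4)²∕3 = 49∕48`).  With `N_P := (d−1)((L−1)∕2)(L+1)`,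
`G := ((d+2)L)²∕4`, `κ′ := (49∕24)·N_P·L⁻²`: if in addition every arc of the current level is `≤ 1∕4`, then for every `z`, `ι ≠ κ`
    `‖log W⟨z+e_ι,κ⟩ − log W⟨z,κ⟩‖ ≤ L⁻²·v + ρ′ + 71κ′·s³ + 40κ′·s·v + 8κ′·v²`,  `ρ′ := (49∕24)·(N_P + 2G)·aW + κ′·(aX² + (5∕2)·aX)`
— the `hstep′` of ✓`sup_bootstrap_two_profile` ∕ `sup_bootstrap_two_profile'` with `r₁ = L⁻²`, `D₃ = 71κ′`, `D_sv = 40κ′`, `D_vv = 8κ′`.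
[cite: Balaban1985RegularSpaces, Lemma 1 (1.24)-(1.26) p.79, (1.29) p.81; Balaban1987RG1, (0.4) p.253] -/
theorem var_le_sup_step_hatLift_poly (hd : P.d = 3) (ht : t + 1 ≤ P.m + P.K) (w : PBond P t → PBond P (t + 1) → ℝ)
    (hw : ∀ b e, w b e = if e.dir = b.dir ∧ (b.src b.dir - emb e.src b.dir).val < P.L then
      ∏ ν ∈ Finset.univ.erase b.dir, max 0 (1 - ((rel (emb e.src) b.src ν).natAbs : ℝ) / P.L) else 0)
    (X : GaugeField P (t + 1) SU2) (V : GaugeField P t SU2)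
    (hV : ∀ b, V b = expPoint (∑ e, w b e • ((P.L : ℝ)⁻¹ • logVec (su2Quat (X e)))))
    (W : GaugeField P t SU2)
    (hax : ∀ z : Site P t, axialT W (emb (blockOf z)) z = axialT V (emb (blockOf z)) z)
    (hT5 : avgFun T3UnitLawDensityEML.ℰp W = X)
    {aW aX s v : ℝ} (haW : 0 ≤ aW) (hWs : PlaqSmall aW W)
    (hg1 : ((((P.d + 2) * P.L : ℕ) : ℝ) ^ 2 / 4) * aW < ExpMeanLog.deltaSU (Fin 2))
    (hg2 : ((((P.d + 2) * P.L : ℕ) : ℝ) ^ 2 / 4) * aW ≤ 1 / 6)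
    (hXp : ∀ q : Plaq P (t + 1), dist1 (GaugeField.plaqHol X q) ≤ aX)
    (hs : ∀ e : PBond P (t + 1), ‖logVec (su2Quat (X e))‖ ≤ s) (hs4 : s ≤ 1 / 4)
    (hv : ∀ (y : Site P (t + 1)) (ι κ : Fin P.d), ι ≠ κ →
      ‖logVec (su2Quat (X ⟨y.shift ι, κ⟩)) - logVec (su2Quat (X ⟨y, κ⟩))‖ ≤ v)
    (hW4 : ∀ b : PBond P t, ‖logVec (su2Quat (W b))‖ ≤ 1 / 4)
    (z : Site P t) {ι κ : Fin P.d} (hικ : ι ≠ κ) :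
    ‖logVec (su2Quat (W ⟨z.shift ι, κ⟩)) - logVec (su2Quat (W ⟨z, κ⟩))‖ ≤ ((P.L : ℝ)⁻¹) ^ 2 * v +
      (49 / 24 * ((((P.d - 1) * ((P.L - 1) / 2) * (P.L + 1) : ℕ) : ℝ) + 2 * ((((P.d + 2) * P.L : ℕ) : ℝ) ^ 2 / 4)) * aW +
        49 / 24 * (((P.d - 1) * ((P.L - 1) / 2) * (P.L + 1) : ℕ) : ℝ) * ((P.L : ℝ)⁻¹) ^ 2 * (aX ^ 2 + 5 / 2 * aX)) +
      71 * (49 / 24 * (((P.d - 1) * ((P.L - 1) / 2) * (P.L + 1) : ℕ) : ℝ) * ((P.L : ℝ)⁻¹) ^ 2) * s ^ 3 +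
      40 * (49 / 24 * (((P.d - 1) * ((P.L - 1) / 2) * (P.L + 1) : ℕ) : ℝ) * ((P.L : ℝ)⁻¹) ^ 2) * s * v +
      8 * (49 / 24 * (((P.d - 1) * ((P.L - 1) / 2) * (P.L + 1) : ℕ) : ℝ) * ((P.L : ℝ)⁻¹) ^ 2) * v ^ 2 := by
  obtain ⟨e₀⟩ : Nonempty (PBond P (t + 1)) := ⟨⟨default, ⟨0, P.hd⟩⟩⟩
  have hs0 : 0 ≤ s := (norm_nonneg _).trans (hs e₀)
  have haX : 0 ≤ aX := (GaugeGroup.dist1_nonneg _).trans (hXp ⟨default, ⟨0, P.hd⟩, ⟨1, by rw [hd]; norm_num⟩, by simp [Fin.lt_def]⟩)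
  have hL0 : 0 ≤ (P.L : ℝ)⁻¹ := inv_nonneg.mpr (Nat.cast_nonneg _)
  have hL1 : (P.L : ℝ)⁻¹ ≤ 1 := inv_le_one_of_one_le₀ (by exact_mod_cast P.L_pos)
  have hsσ : (P.L : ℝ)⁻¹ * s ≤ 1 / 4 := (mul_le_of_le_one_left hs0 hL1).trans hs4
  have h := var_le_sup_step_hatLift hd ht w hw X V hV W hax hT5 haW hWs hg1 hg2 hXp hs hs4 hv hW4 hsσ (by norm_num) z hικ
  have hpoly := refined_poly_le (v := v) haX hs0 hs4
  set N : ℝ := (((P.d - 1) * ((P.L - 1) / 2) * (P.L + 1) : ℕ) : ℝ) with hN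
  set G : ℝ := ((((P.d + 2) * P.L : ℕ) : ℝ) ^ 2 / 4) with hG
  set u : ℝ := ((P.L : ℝ)⁻¹) ^ 2 with hu
  have hN0 : 0 ≤ N := by rw [hN]; positivity
  have hu0 : 0 ≤ u := by rw [hu]; positivity
  have hmono : N * (aW + u * (aX + (aX + 12 * s ^ 2) ^ 2 + 40 * s * v + 8 * v ^ 2 + 35 * s ^ 3)) + 2 * (G * aW) ≤
      N * (aW + u * ((aX ^ 2 + 5 / 2 * aX) + 71 * s ^ 3 + 40 * s * v + 8 * v ^ 2)) + 2 * (G * aW) :=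
    add_le_add_left (mul_le_mul_of_nonneg_left (add_le_add_right (mul_le_mul_of_nonneg_left hpoly hu0) aW) hN0) _
  have hk : (2 : ℝ) * (1 + (1 / 4) ^ 2 / 3) = 49 / 24 := by norm_num
  rw [hk] at h
  have h49 : (0 : ℝ) ≤ 49 / 24 := by norm_num
  refine h.trans ((add_le_add_right (mul_le_mul_of_nonneg_left hmono h49) _).trans (le_of_eq ?_))
  ring

/-- ★★ **THE TWO-PROFILE BOOTSTRAP WHOSE `v`-STEP MAY USE THE CURRENT LEVEL's SIZE** — ✓`sup_bootstrap_two_profile` with `hstep′` weakened to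
`s (t+1) ≤ σ₀ → s t ≤ σ₀ → v t ≤ …`: the downward induction proves `s t ≤ M ≤ σ₀` from the `s`-step FIRST and feeds it to the `v`-step (§3's arc hypothesis on
`W`).  Same ceilings, same conclusion `s t ≤ M ∧ v t ≤ N` for all `t ≤ m`. [folklore] -/
theorem sup_bootstrap_two_profile' (s v ρ ρ' : ℕ → ℝ) (m : ℕ) (r₀ r₁ C₃ Csv Cvv D₃ Dsv Dvv σ₀ M N Sρ Sρ' : ℝ)
    (hs : s m ≤ M) (hv : v m ≤ N) (hsnn : ∀ t, 0 ≤ s t) (hvnn : ∀ t, 0 ≤ v t) (hρ : ∀ t, 0 ≤ ρ t) (hρ' : ∀ t, 0 ≤ ρ' t)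
    (hSρ : ∑ t ∈ range m, ρ t ≤ Sρ) (hSρ' : ∑ t ∈ range m, ρ' t ≤ Sρ')
    (hstep : ∀ t, t < m → s (t + 1) ≤ σ₀ →
      s t ≤ r₀ * s (t + 1) + ρ t + C₃ * s (t + 1) ^ 3 + Csv * s (t + 1) * v (t + 1) + Cvv * v (t + 1) ^ 2)
    (hstep' : ∀ t, t < m → s (t + 1) ≤ σ₀ → s t ≤ σ₀ →
      v t ≤ r₁ * v (t + 1) + ρ' t + D₃ * s (t + 1) ^ 3 + Dsv * s (t + 1) * v (t + 1) + Dvv * v (t + 1) ^ 2)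
    (hr0 : 0 ≤ r₀) (hr1 : 0 ≤ r₁) (hC₃ : 0 ≤ C₃) (hCsv : 0 ≤ Csv) (hCvv : 0 ≤ Cvv) (hD₃ : 0 ≤ D₃) (hDsv : 0 ≤ Dsv) (hDvv : 0 ≤ Dvv)
    (hMσ : M ≤ σ₀)
    (hceil : r₀ * M + Sρ + C₃ * M ^ 3 + Csv * M * N + Cvv * N ^ 2 ≤ M)
    (hceil' : r₁ * N + Sρ' + D₃ * M ^ 3 + Dsv * M * N + Dvv * N ^ 2 ≤ N) :
    ∀ t, t ≤ m → s t ≤ M ∧ v t ≤ N := by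
  have hM0 : 0 ≤ M := (hsnn m).trans hs
  have hN0 : 0 ≤ N := (hvnn m).trans hv
  suffices h : ∀ k, ∀ t, t + k = m → s t ≤ M ∧ v t ≤ N by
    intro t ht
    exact h (m - t) t (by omega)
  intro k
  induction k with
  | zero =>
    intro t ht
    have htm : t = m := by omega
    rw [htm]
    exact ⟨hs, hv⟩
  | succ k ih =>
    intro t ht
    have ht' : t < m := by omega
    obtain ⟨hS, hV⟩ := ih (t + 1) (by omega)
    have hS0 : 0 ≤ s (t + 1) := hsnn (t + 1)
    have hV0 : 0 ≤ v (t + 1) := hvnn (t + 1)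
    have h3 : s (t + 1) ^ 3 ≤ M ^ 3 := pow_le_pow_left₀ hS0 hS 3
    have hsv : s (t + 1) * v (t + 1) ≤ M * N := mul_le_mul hS hV hV0 hM0
    have hvv : v (t + 1) ^ 2 ≤ N ^ 2 := pow_le_pow_left₀ hV0 hV 2
    have hρt : ρ t ≤ Sρ := le_of_sum_le_of_nonneg ρ m Sρ hρ hSρ t ht'
    have hρ't : ρ' t ≤ Sρ' := le_of_sum_le_of_nonneg ρ' m Sρ' hρ' hSρ' t ht'
    -- the `s`-bound of the current level FIRST
    have hSt : s t ≤ M := by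
      calc s t ≤ r₀ * s (t + 1) + ρ t + C₃ * s (t + 1) ^ 3 + Csv * s (t + 1) * v (t + 1) + Cvv * v (t + 1) ^ 2 :=
            hstep t ht' (hS.trans hMσ)
        _ ≤ r₀ * M + Sρ + C₃ * M ^ 3 + Csv * (M * N) + Cvv * N ^ 2 := by
            have e1 := mul_le_mul_of_nonneg_left hS hr0
            have e2 := mul_le_mul_of_nonneg_left h3 hC₃
            have e3 := mul_le_mul_of_nonneg_left hsv hCsv
            have e4 := mul_le_mul_of_nonneg_left hvv hCvv
            rw [mul_assoc]
            linarith
        _ ≤ M := by rw [← mul_assoc]; exact hceil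
    refine ⟨hSt, ?_⟩
    calc v t ≤ r₁ * v (t + 1) + ρ' t + D₃ * s (t + 1) ^ 3 + Dsv * s (t + 1) * v (t + 1) + Dvv * v (t + 1) ^ 2 :=
          hstep' t ht' (hS.trans hMσ) (hSt.trans hMσ)
      _ ≤ r₁ * N + Sρ' + D₃ * M ^ 3 + Dsv * (M * N) + Dvv * N ^ 2 := by
          have e1 := mul_le_mul_of_nonneg_left hV hr1
          have e2 := mul_le_mul_of_nonneg_left h3 hD₃
          have e3 := mul_le_mul_of_nonneg_left hsv hDsv
          have e4 := mul_le_mul_of_nonneg_left hvv hDvv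
          rw [mul_assoc]
          linarith
      _ ≤ N := by rw [← mul_assoc]; exact hceil'

end Recursion

end Summit.QuantumFields.YangMills.Theorems.FluctuationComparisonRegPrIntLS2BetaRelativeTowerVarStep

end
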